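import Summits.HodgeConjecture.HodgeConjecture.Cruxes.BlochSeedDiscOne.SeedChecker
import Literature.AlgebraicGeometry.Modules.VanishingLocusFiniteLocallyFree
import Literature.AlgebraicGeometry.HodgeTheory.ZeroSchemeRegularImmersion
import Literature.AlgebraicGeometry.Modules.RankOneCocycle
import Literature.AlgebraicGeometry.Modules.DetClassOfIso
import Literature.AlgebraicGeometry.Modules.ExtCohomologyComparison
import Literature.AlgebraicGeometry.Motives.DivisorOfSectionCohomologySequence
import HarnessLib

/-!
# `Cruxes/BlochSeedDiscOne/SeedCheckerZeroLocus.lean` — SEED CHECKER v16 (§19): THE CARRIER IS NOT AN INPUT —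
# the zero scheme of the presentation's section EXISTS, is UNIQUE, and has `4` local equations BY CONSTRUCTION

`line stmt-HodgeConjecture-18881 Cruxes/BlochSeedDiscOne/Lines/birth.lean 814a6a70c14e831a stub_rung_pad4_seedAt` —
unit `hsemireg-c5c8-1` gen 15 (MINT block A5, explicit unit «type C5–C8 as predicates on (design json, presentation) so a
seed checker exists before a candidate does; flag the vacuous ∕ implied ones»). Satellite of v4 `SeedChecker.lean`
(the only BUILT checker module on the farm; the satellites v5–v15.1 are in the tree but not yet built, so this file imports
v4 only and re-proves nothing of theirs) and of the tree's zero-scheme API (`Modules/ZeroSchemeOfSection`,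
`Modules/ZeroSchemeUniversal`, `Modules/VanishingLocusOfHom`, `Modules/VanishingLocusFiniteLocallyFree`,
`HodgeTheory/ZeroSchemeRegularImmersion`; Fulton, *Intersection Theory*, App. B.3.2 and B.3.4, PDF pp. 410–411).

## §19.0 Honest framing (read first)

NOTHING toward HC ∕ HC_CM ∕ HC_AV ∕ № 4 ∕ 26512 ∕ 18881 ∕ H2 is proved here. No design json, no presentation, no bundle, no
section, no seed is CONSTRUCTED; `stub_rung_pad4_seedAt` and the crux `EightfoldBlochSeeds.BlochSeedDiscOne` stay exactly as
open as before. This file is EVIDENCE + TYPED PLUMBING for the seed checker: it removes one free input from v4's lci door.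

## What v4 left as a free input, and what this file does with it

v4's lci door `Design.seedCheck_of_zeroScheme` ∕ `blochSeedDiscOne_of_zeroSchemes` reads a design `D` (C0), a rank-`4`
presentation `𝓕` ((A1) at the seed), a section `s : 𝒪 → 𝓕`, AND a carrier `i : Z ↪ S⁴` together with the predicate
`IsZeroSchemeOf s i` («`i` is the zero scheme of `s`»: closed immersion, `i^*s = 0`, universal) — then C5 (regular immersion of
codimension `4`), C6 (integral, codimension `≥ 4`), C7 (Bloch-semiregular) are read ON `i`. v15 (`SeedCheckerMacaulay`, §18,
unbuilt) showed C5 ⟸ C6-codim GIVEN «closed immersion + `4` local equations» (`LocallyGeneratedBy i 4`), again a hypothesis on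
the carrier. Here (everything PROVED, kernel-checked, no `sorry`, no new axiom):

* §19.1 `vanishingIdeal_mulSection`, `eq_mulSection`, `vanishingIdeal_eq_zeroSchemeIdeal` — a section `s : 𝒪_X → 𝓕` IS
  `a ↦ a·t` for `t = s(1)` (tree `Modules.mulSection`, `app_top_one_injective`), and the tree's vanishing ideal of the
  morphism `s` (`Modules.vanishingIdeal`) IS the tree's zero-scheme ideal of the section `t` (`Modules.zeroSchemeIdeal`,
  Fulton B.3.4 «the image of `ℰ^∨ → 𝒪_X`»).
* §19.2 **EXISTENCE AND UNIQUENESS OF THE CARRIER**: for `𝓕` finite locally free, v4's predicate is INHABITED by the tree's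
  construction — `isZeroSchemeOf_zeroSchemeι : IsZeroSchemeOf s (zeroSchemeι 𝓕 (s 1))` (Fulton B.3.2 ∕ EGA I 9.7.9: `Z(t)`
  represents the vanishing of `t`, tree `exists_comp_subschemeι_eq_iff`, `pullback_subschemeι_map_eq_zero`) — and any two
  zero schemes of `s` are UNIQUELY ISOMORPHIC over `X` (`IsZeroSchemeOf.exists_iso`, `….hom_unique`), hence have the same
  ideal sheaf (`IsZeroSchemeOf.ker_eq`, `….ker_eq_zeroSchemeIdeal`) and the same support (`IsZeroSchemeOf.range_eq`); in sum
  `isZeroSchemeOf_iff_exists_iso`: **`IsZeroSchemeOf s i` ⟺ `i` is isomorphic over `X` to `Z(s(1)) ↪ X`** — the carrier is a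
  FUNCTION of the presentation, not a datum.
* §19.3 **FULTON B.3.2 — `4` LOCAL EQUATIONS BY CONSTRUCTION**: the ideal of ANY zero scheme of a section of a bundle of rank
  `r` is, on an affine neighbourhood of EVERY point of `X`, `Ideal.ofList` of the `r` frame coordinates of the section
  (`exists_ofList_eq_ker_ideal`, `locallyGeneratedBy_of_isZeroSchemeOf` — the latter literally v15's `LocallyGeneratedBy i r`
  body, so the joint file bridges by `Iff.rfl`): v15's hypothesis `hgen` and v4 ∕ v15's `[IsClosedImmersion i]` are DISCHARGED for
  zero schemes of rank-`4` presentations (flag: IMPLIED by `HasRank 𝓕 4`).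
* §19.4 **FULTON B.3.4 — C5 FROM REGULAR FRAME COORDINATES**: the checkable test on the presentation `HasRegularCoordinatesAt 𝓕 t r x`
  (the `r` coordinates of `t` in SOME frame form a weakly regular sequence on an affine neighbourhood of `x`) at the points of
  `Z(t)` gives C5 for `Z(t)` and for every zero scheme of `s` (`isRegularImmersionOfCodim_of_hasRegularCoordinatesAt`; tree
  `isRegularImmersionOfCodim_zeroSchemeι_of_isFiniteLocallyFree`).
* §19.5 **MODEL INDEPENDENCE OF THE VERDICT**: C5, C6 (integrality, codimension) and the (σ) support clause transfer between any two
  zero schemes of the same section (`…of_iso` lemmas); C7 (`IsBlochSemiregular i 8 4`) is NOT transferred here (the tree's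
  `IsBlochSemiregular.comp_iso` is invariance under isomorphisms of the AMBIENT scheme, not of `Z`) — flagged, and carried as a
  hypothesis on the new model in `Design.SeedCheck.of_isZeroSchemeOf`.
* §19.6 **THE DOORS WITH NO CARRIER INPUT**: `Design.seedCheck_of_section` ∕ `Design.seedCheck_of_regularSection` ∕
  `blochSeedDiscOne_of_sections` — input = (design json `D`, presentation `𝓕` of rank `4`, a global section `t`), conditions =
  C0(json) ∧ (A1@seed) ∧ C5(Z(t)) [or: regular coordinates] ∧ C6(Z(t)) ∧ C7(Z(t)), GIVEN the named law
  `TopChernFourLocalisation C` exactly as in v4; conclusion `∃ q, D.SeedCheck K (zeroSchemeι 𝓕 t) q`, resp. the crux BY NAME.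
* §19.7 flags and audit (`audit_nothing_decided`).

Typer lint: no `instance`, no `notation` ∕ `macro`, no `axiom`, no `sorry`, no `allowUnsafeReducibility`; `set_option
linter.dupNamespace false` only (Cruxes workfile convention v4–v15).

## References
* [Fulton1998] W. Fulton, *Intersection Theory*, 2nd ed. (1998), App. B.3.2, B.3.4 (PDF pp. 410–411), §14.1 (PDF p. 236),
  Example 6.3.4 (a) (PDF p. 103).
* [EGA1] A. Grothendieck, J. Dieudonné, EGA I (1971), (9.7.9.1) (the subscheme of zeros of a section).
* [GortzWedhorn2023] U. Görtz, T. Wedhorn, *Algebraic Geometry II* (2023), Def. 19.19, Def. 19.23 (regular immersions).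
* [Hartshorne1977] R. Hartshorne, *Algebraic Geometry* (1977), II Prop. 5.9 (PDF p. 146).
-/

noncomputable section

set_option linter.dupNamespace false

open CategoryTheory AlgebraicGeometry TopologicalSpace Opposite
open Literature.AlgebraicGeometry Literature.AlgebraicGeometry.Motives Literature.AlgebraicGeometry.HodgeTheory
open Literature.AlgebraicGeometry.Modules

namespace Summit.HodgeConjecture.HodgeConjecture.Cruxes.BlochSeedDiscOne.SeedChecker.ZeroLocus

open Summit.HodgeConjecture.HodgeConjecture.Cruxes.BlochSeedDiscOne.Anchor
open Summit.Ventures.HSemireg Summit.Ventures.HSemireg.Pad4Tower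

/-! ## §19.1 Sections versus morphisms `𝒪_X → 𝓕`; the vanishing ideal of `s` is the zero-scheme ideal of `s(1)` -/

section Sections

variable {X : Scheme.{0}} {𝓕 : X.Modules}

/-- the section `t = s(1) ∈ Γ(X, 𝓕)` of a morphism `s : 𝒪_X → 𝓕` (tree `homTopAddEquivSections`). -/
abbrev secOf (s : unitModule X ⟶ 𝓕) : Γ(𝓕, ⊤) :=
  s.app ⊤ (1 : Γ(X, ⊤))

/-- `(mulSection t)(1) = t` on every open: `1 • t|_W = t|_W`. -/
theorem mulSection_app_one (t : Γ(𝓕, ⊤)) (W : X.Opens) :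
    (mulSection 𝓕 t).app W (1 : Γ(X, W)) = resTop 𝓕 t W := by
  rw [mulSection_app]
  exact one_smul _ _

/-- **the values of `a ↦ a·t` are the multiples of the values of `t`**: on every open `W`, the tree's ideal of values of the
MORPHISM `mulSection 𝓕 t` (`vanishingValueIdeal`, generators `μ_W(a·t|_W)`) is the tree's ideal of values of the SECTION `t`
(`sectionValueIdeal`, generators `μ_W(t|_W)`). [cite: Fulton1998, B.3.4 (PDF p. 410)] -/
theorem vanishingValueIdeal_mulSection (t : Γ(𝓕, ⊤)) (W : X.Opens) :
    vanishingValueIdeal (mulSection 𝓕 t) W = sectionValueIdeal 𝓕 t W := by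
  refine le_antisymm (Ideal.span_le.2 ?_) (Ideal.span_le.2 ?_)
  · rintro _ ⟨⟨a, μ⟩, rfl⟩
    have h : (show Γ(X, W) from a) * sectionValue 𝓕 t μ = appLE μ (𝟙 W) ((mulSection 𝓕 t).app W a) := by
      rw [mulSection_app, appLE_smul_right, sectionValue_def]
      rfl
    change (appLE μ (𝟙 W) ((mulSection 𝓕 t).app W a) : Γ(X, W)) ∈ sectionValueIdeal 𝓕 t W
    rw [← h]
    exact (sectionValueIdeal 𝓕 t W).mul_mem_left _ (sectionValue_mem 𝓕 t μ)
  · rintro _ ⟨μ, rfl⟩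
    change sectionValue 𝓕 t μ ∈ vanishingValueIdeal (mulSection 𝓕 t) W
    rw [sectionValue_def, ← mulSection_app_one t W]
    exact appLE_app_mem (mulSection 𝓕 t) W _ μ

/-- **the vanishing ideal sheaf of `a ↦ a·t` IS the ideal sheaf of `Z(t)`** (both are Mathlib's `IdealSheafData.ofIdeals` of the
ideals of values, which agree by `vanishingValueIdeal_mulSection`). [cite: Fulton1998, B.3.4 (PDF p. 410)] -/
theorem vanishingIdeal_mulSection (t : Γ(𝓕, ⊤)) : vanishingIdeal (mulSection 𝓕 t) = zeroSchemeIdeal 𝓕 t := by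
  unfold vanishingIdeal zeroSchemeIdeal
  congr 1
  funext W
  exact vanishingValueIdeal_mulSection t W

/-- **every morphism `s : 𝒪_X → 𝓕` is multiplication by its section `s(1)`** (`Hom(𝒪_X, 𝓕) = Γ(X, 𝓕)`, tree
`app_top_one_injective` + `mulSection_app_top_one`). [cite: Hartshorne1977, II.5 (p. 109)] -/
theorem eq_mulSection (s : unitModule X ⟶ 𝓕) : s = mulSection 𝓕 (secOf s) :=
  app_top_one_injective 𝓕 (show s.app ⊤ (1 : Γ(X, ⊤)) = (mulSection 𝓕 (secOf s)).app ⊤ (1 : Γ(X, ⊤)) by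
    rw [mulSection_app_top_one])

/-- **the vanishing ideal sheaf of `s` is the ideal sheaf of the zero scheme of `s(1)`.** [cite: Fulton1998, B.3.4 (PDF p. 410)] -/
theorem vanishingIdeal_eq_zeroSchemeIdeal (s : unitModule X ⟶ 𝓕) : vanishingIdeal s = zeroSchemeIdeal 𝓕 (secOf s) := by
  conv_lhs => rw [eq_mulSection s]
  exact vanishingIdeal_mulSection _

end Sections

/-! ## §19.2 Existence and uniqueness of the zero scheme: v4's `IsZeroSchemeOf s ·` is inhabited, canonically -/

section Existence

variable {X : Scheme.{0}} {𝓕 : X.Modules}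

/-- **THE VANISHING LOCUS `V(s) ↪ X` IS A ZERO SCHEME OF `s`** in v4's sense, for `𝓕` finite locally free: closed immersion (Mathlib
`IdealSheafData.subschemeι`), `ι^*s = 0` (tree `pullback_subschemeι_map_eq_zero`) and universal (tree `exists_comp_subschemeι_eq_iff`;
side conditions: `𝒪_X` is affine-localizing, `IsAffineLocalizing.unit`; `𝓕^∨` is, `isAffineLocalizing_dual_of_isFiniteLocallyFree`).
[cite: Fulton1998, B.3.2 (PDF p. 410)] [cite: Hartshorne1977, II Prop. 5.9 (PDF p. 146)] -/
theorem isZeroSchemeOf_subschemeι (h𝓕 : IsFiniteLocallyFree 𝓕) (s : unitModule X ⟶ 𝓕) :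
    IsZeroSchemeOf s (vanishingIdeal s).subschemeι := by
  have hV := Modules.isAffineLocalizing_dual_of_isFiniteLocallyFree h𝓕
  refine ⟨inferInstance, pullback_subschemeι_map_eq_zero s (frameSystemOfIsFiniteLocallyFree h𝓕)
    IsAffineLocalizing.unit hV, fun T g hg => ?_⟩
  exact (exists_comp_subschemeι_eq_iff s g (frameSystemOfIsFiniteLocallyFree h𝓕) IsAffineLocalizing.unit hV).mpr hg

/-- **THE TREE'S ZERO SCHEME `Z(s(1)) ↪ X` IS A ZERO SCHEME OF `s`** (`Modules.zeroSchemeι`; same closed subscheme, by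
`vanishingIdeal_eq_zeroSchemeIdeal`). This is the canonical carrier the checker reads below. [cite: Fulton1998, B.3.2 (PDF p. 410)] -/
theorem isZeroSchemeOf_zeroSchemeι (h𝓕 : IsFiniteLocallyFree 𝓕) (s : unitModule X ⟶ 𝓕) :
    IsZeroSchemeOf s (zeroSchemeι 𝓕 (secOf s)) := by
  have h := isZeroSchemeOf_subschemeι h𝓕 s
  rw [vanishingIdeal_eq_zeroSchemeIdeal] at h
  exact h

/-- … in section form: `Z(t) ↪ X` is a zero scheme of `a ↦ a·t`. [cite: Fulton1998, B.3.2 (PDF p. 410)] -/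
theorem isZeroSchemeOf_mulSection (h𝓕 : IsFiniteLocallyFree 𝓕) (t : Γ(𝓕, ⊤)) :
    IsZeroSchemeOf (mulSection 𝓕 t) (zeroSchemeι 𝓕 t) := by
  have h := isZeroSchemeOf_subschemeι h𝓕 (mulSection 𝓕 t)
  rw [vanishingIdeal_mulSection] at h
  exact h

/-- **EXISTENCE**: every section of a finite locally free module has a zero scheme in v4's sense. -/
theorem exists_isZeroSchemeOf (h𝓕 : IsFiniteLocallyFree 𝓕) (s : unitModule X ⟶ 𝓕) :
    ∃ (Z : Scheme.{0}) (i : Z ⟶ X), IsZeroSchemeOf s i :=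
  ⟨_, _, isZeroSchemeOf_zeroSchemeι h𝓕 s⟩

variable {s : unitModule X ⟶ 𝓕} {Z Z' : Scheme.{0}} {i : Z ⟶ X} {i' : Z' ⟶ X}

/-- **UNIQUENESS**: two zero schemes of the same section are isomorphic over `X` (both represent the vanishing sub-functor of `s`;
closed immersions are monomorphisms), the isomorphism being unique. No hypothesis on `𝓕`. [cite: Fulton1998, B.3.2 (PDF p. 410)] -/
theorem _root_.Summit.HodgeConjecture.HodgeConjecture.Cruxes.BlochSeedDiscOne.SeedChecker.IsZeroSchemeOf.exists_iso
    (hZ : IsZeroSchemeOf s i) (hZ' : IsZeroSchemeOf s i') : ∃ e : Z ≅ Z', e.hom ≫ i' = i ∧ e.inv ≫ i = i' := by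
  obtain ⟨f, hf⟩ := hZ'.2.2 i hZ.2.1
  obtain ⟨g, hg⟩ := hZ.2.2 i' hZ'.2.1
  haveI := hZ.1
  haveI := hZ'.1
  refine ⟨⟨f, g, ?_, ?_⟩, hf, hg⟩
  · rw [← cancel_mono i, Category.assoc, hg, hf, Category.id_comp]
  · rw [← cancel_mono i', Category.assoc, hf, hg, Category.id_comp]

/-- the isomorphism between two zero schemes of `s` is unique. -/
theorem _root_.Summit.HodgeConjecture.HodgeConjecture.Cruxes.BlochSeedDiscOne.SeedChecker.IsZeroSchemeOf.hom_unique
    (hZ' : IsZeroSchemeOf s i') {f f' : Z ⟶ Z'} (hf : f ≫ i' = i) (hf' : f' ≫ i' = i) : f = f' := by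
  haveI := hZ'.1
  exact (cancel_mono i').mp (hf.trans hf'.symm)

/-- two zero schemes of the same section have THE SAME IDEAL SHEAF (Mathlib `Scheme.Hom.ker`). -/
theorem _root_.Summit.HodgeConjecture.HodgeConjecture.Cruxes.BlochSeedDiscOne.SeedChecker.IsZeroSchemeOf.ker_eq
    (hZ : IsZeroSchemeOf s i) (hZ' : IsZeroSchemeOf s i') : i.ker = i'.ker := by
  obtain ⟨e, he, -⟩ := hZ.exists_iso hZ'
  rw [← he, Scheme.Hom.ker_comp_of_isIso]

/-- two zero schemes of the same section have THE SAME SUPPORT `i(Z) ⊆ X`. -/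
theorem _root_.Summit.HodgeConjecture.HodgeConjecture.Cruxes.BlochSeedDiscOne.SeedChecker.IsZeroSchemeOf.range_eq
    (hZ : IsZeroSchemeOf s i) (hZ' : IsZeroSchemeOf s i') : Set.range i.base = Set.range i'.base := by
  obtain ⟨e, he, he'⟩ := hZ.exists_iso hZ'
  refine le_antisymm ?_ ?_
  · rintro _ ⟨z, rfl⟩
    exact ⟨e.hom.base z, by rw [← he, Scheme.Hom.comp_apply]⟩
  · rintro _ ⟨z', rfl⟩
    exact ⟨e.inv.base z', by rw [← he', Scheme.Hom.comp_apply]⟩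

/-- **the ideal sheaf of ANY zero scheme of `s` is the zero-scheme ideal of `s(1)`** (`𝓕` finite locally free). -/
theorem _root_.Summit.HodgeConjecture.HodgeConjecture.Cruxes.BlochSeedDiscOne.SeedChecker.IsZeroSchemeOf.ker_eq_zeroSchemeIdeal
    (h𝓕 : IsFiniteLocallyFree 𝓕) (hZ : IsZeroSchemeOf s i) : i.ker = zeroSchemeIdeal 𝓕 (secOf s) := by
  rw [hZ.ker_eq (isZeroSchemeOf_zeroSchemeι h𝓕 s), ker_zeroSchemeι]

/-- the support of ANY zero scheme of `s` is that of `Z(s(1))`. -/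
theorem _root_.Summit.HodgeConjecture.HodgeConjecture.Cruxes.BlochSeedDiscOne.SeedChecker.IsZeroSchemeOf.range_eq_zeroSchemeι
    (h𝓕 : IsFiniteLocallyFree 𝓕) (hZ : IsZeroSchemeOf s i) :
    Set.range i.base = Set.range (zeroSchemeι 𝓕 (secOf s)).base :=
  hZ.range_eq (isZeroSchemeOf_zeroSchemeι h𝓕 s)

/-- v4's predicate is stable under isomorphisms over `X` (tree `pullback_comp_map_eq_zero`). -/
theorem _root_.Summit.HodgeConjecture.HodgeConjecture.Cruxes.BlochSeedDiscOne.SeedChecker.IsZeroSchemeOf.of_iso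
    (hZ : IsZeroSchemeOf s i) (e : Z' ≅ Z) : IsZeroSchemeOf s (e.hom ≫ i) := by
  haveI := hZ.1
  refine ⟨inferInstance, pullback_comp_map_eq_zero s i e.hom hZ.2.1, fun T g hg => ?_⟩
  obtain ⟨g', hg'⟩ := hZ.2.2 g hg
  exact ⟨g' ≫ e.inv, by rw [Category.assoc, e.inv_hom_id_assoc, hg']⟩

/-- **CHARACTERISATION OF v4's PREDICATE**: for `𝓕` finite locally free, `i : Z ↪ X` is a zero scheme of `s` IFF `i` is
isomorphic over `X` to the tree's `Z(s(1)) ↪ X` — the carrier is determined by the presentation up to unique isomorphism.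
[cite: Fulton1998, B.3.2 (PDF p. 410)] -/
theorem isZeroSchemeOf_iff_exists_iso (h𝓕 : IsFiniteLocallyFree 𝓕) :
    IsZeroSchemeOf s i ↔ ∃ e : Z ≅ zeroScheme 𝓕 (secOf s), e.hom ≫ zeroSchemeι 𝓕 (secOf s) = i := by
  refine ⟨fun hZ => ?_, ?_⟩
  · obtain ⟨e, he, -⟩ := hZ.exists_iso (isZeroSchemeOf_zeroSchemeι h𝓕 s)
    exact ⟨e, he⟩
  · rintro ⟨e, rfl⟩
    exact (isZeroSchemeOf_zeroSchemeι h𝓕 s).of_iso e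

end Existence

/-! ## §19.3 Fulton B.3.2: the ideal of a zero scheme of a section of a rank-`r` bundle has `r` local generators everywhere -/

section Generators

variable {X : Scheme.{0}} {𝓕 : X.Modules} {r : ℕ}

/-- **`r` LOCAL EQUATIONS AT EVERY POINT OF `X`**: for `𝓕` of rank `r` and `t ∈ Γ(X, 𝓕)`, every point `x ∈ X` has an affine
neighbourhood `U` on which the ideal of `Z(t) ↪ X` is `Ideal.ofList` of `r` elements — the `r` coordinates of `t|_U` in a frame
(tree `exists_frameSystem_of_hasRank`, `ker_zeroSchemeι_ideal_eq_ofList`; affine opens are a basis). [cite: Fulton1998, B.3.2 (PDF p. 410)] -/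
theorem exists_ofList_eq_ker_ideal (hr : HasRank 𝓕 r) (t : Γ(𝓕, ⊤)) (x : X) :
    ∃ U : X.affineOpens, x ∈ (U : X.Opens) ∧
      ∃ rs : List Γ(X, U), rs.length = r ∧ Ideal.ofList rs = (zeroSchemeι 𝓕 t).ker.ideal U := by
  obtain ⟨F, hF⟩ := exists_frameSystem_of_hasRank hr
  obtain ⟨V, hV, hxV, hVW⟩ := Opens.isBasis_iff_nbhd.mp X.isBasis_affineOpens (F.mem x)
  haveI : Fintype (F.I x) := Fintype.ofEquiv _ (F.enum x).symm
  let σ : Fin r ≃ F.I x := (finCongr (hF x)).symm.trans (F.enum x).symm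
  exact ⟨⟨V, hV⟩, hxV, List.ofFn fun j => coord (F.frame x) (homOfLE hVW) (resTop 𝓕 t V) (σ j), List.length_ofFn,
    (ker_zeroSchemeι_ideal_eq_ofList (HodgeTheory.isAffineLocalizing_dual_of_isFiniteLocallyFree (HasRank.isFiniteLocallyFree' hr))
      t (F.frame x) σ ⟨V, hV⟩ (homOfLE hVW)).symm⟩

/-- **v15's hypothesis `LocallyGeneratedBy i r`, DISCHARGED for every zero scheme of a section of a rank-`r` bundle** — stated as
v15's literal body (`SeedCheckerMacaulay.LocallyGeneratedBy`, not importable here: unbuilt), so the joint file bridges by `Iff.rfl`: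
every `z ∈ Z` has an affine neighbourhood `U ∋ i(z)` in `X` with `i.ker(U) = Ideal.ofList rs`, `rs.length = r`.
[cite: Fulton1998, B.3.2 and B.3.4 (PDF pp. 410–411)] [cite: GortzWedhorn2023, Def. 19.19] -/
theorem locallyGeneratedBy_of_isZeroSchemeOf (hr : HasRank 𝓕 r) {s : unitModule X ⟶ 𝓕} {Z : Scheme.{0}} {i : Z ⟶ X}
    (hZ : IsZeroSchemeOf s i) :
    ∀ z : Z, ∃ U : X.affineOpens, i.base z ∈ (U : X.Opens) ∧
      ∃ rs : List Γ(X, U), rs.length = r ∧ Ideal.ofList rs = i.ker.ideal U := by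
  intro z
  obtain ⟨U, hzU, rs, hlen, hI⟩ := exists_ofList_eq_ker_ideal hr (secOf s) (i.base z)
  refine ⟨U, hzU, rs, hlen, ?_⟩
  rw [hZ.ker_eq_zeroSchemeIdeal (HasRank.isFiniteLocallyFree' hr), ← ker_zeroSchemeι]
  exact hI

/-- the same for the canonical carrier `Z(t) ↪ X`, at the points of `Z(t)`. [cite: Fulton1998, B.3.2 (PDF p. 410)] -/
theorem locallyGeneratedBy_zeroSchemeι (hr : HasRank 𝓕 r) (t : Γ(𝓕, ⊤)) :
    ∀ z : zeroScheme 𝓕 t, ∃ U : X.affineOpens, (zeroSchemeι 𝓕 t).base z ∈ (U : X.Opens) ∧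
      ∃ rs : List Γ(X, U), rs.length = r ∧ Ideal.ofList rs = (zeroSchemeι 𝓕 t).ker.ideal U :=
  fun z => exists_ofList_eq_ker_ideal hr t ((zeroSchemeι 𝓕 t).base z)

end Generators

/-! ## §19.4 Fulton B.3.4: C5 from regular frame coordinates (the practical test on the presentation) -/

section Regular

variable {X : Scheme.{0}} (𝓕 : X.Modules)

/-- **REGULAR COORDINATES OF `t` AT `x` (the presentation-side C5 test)**: there are an affine open `V ∋ x`, a frame
`e : 𝒪^r ≅ 𝓕|_W` over `W ⊇ V` indexed by `Fin r`, such that the `r` coordinate functions `λ₀(t|_V), …, λ_{r-1}(t|_V) ∈ Γ(X, V)`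
form a WEAKLY REGULAR SEQUENCE (Mathlib `RingTheory.Sequence.IsWeaklyRegular`) — Fulton's «`s` is given by a sequence
`(s_1, …, s_r)` … regular sequence», on an affine neighbourhood rather than at the stalk. A predicate on (presentation, section,
point); nothing asserts it. [cite: Fulton1998, B.3.4 (PDF p. 411)] -/
def HasRegularCoordinatesAt (t : Γ(𝓕, ⊤)) (r : ℕ) (x : X) : Prop :=
  ∃ (V : X.affineOpens) (W : X.Opens) (k : (V : X.Opens) ⟶ W) (e : SheafOfModules.free (Fin r) ≅ 𝓕.over W),
    x ∈ (V : X.Opens) ∧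
      RingTheory.Sequence.IsWeaklyRegular Γ(X, (V : X.Opens)) (List.ofFn fun j => coord e k (resTop 𝓕 t V) j)

variable {𝓕} {r : ℕ}

/-- **C5 FOR `Z(t)` FROM REGULAR COORDINATES AT ITS POINTS** (Fulton B.3.4 via the tree's
`isRegularImmersionOfCodim_zeroSchemeι_of_isFiniteLocallyFree`): `Z(t) ↪ X` is a regular immersion of codimension `r`.
[cite: Fulton1998, B.3.4 (PDF p. 411)] [cite: GortzWedhorn2023, Def. 19.19 and Def. 19.23] -/
theorem isRegularImmersionOfCodim_zeroSchemeι_of_hasRegularCoordinatesAt (h𝓕 : IsFiniteLocallyFree 𝓕) (t : Γ(𝓕, ⊤))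
    (h : ∀ x ∈ Set.range (zeroSchemeι 𝓕 t).base, HasRegularCoordinatesAt 𝓕 t r x) :
    IsRegularImmersionOfCodim (zeroSchemeι 𝓕 t) r := by
  refine isRegularImmersionOfCodim_zeroSchemeι_of_isFiniteLocallyFree (I := Fin r) h𝓕 t fun z => ?_
  obtain ⟨V, W, k, e, hzV, hreg⟩ := h _ ⟨z, rfl⟩
  exact ⟨V, W, k, e, Equiv.refl (Fin r), hzV, hreg⟩

end Regular

/-! ## §19.5 Model independence: the checker's clauses transfer between zero schemes of the same section -/

section Transfer

variable {X : Scheme.{0}} {Z Z' : Scheme.{0}} {i : Z ⟶ X} {i' : Z' ⟶ X}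

/-- C5 transfers along an isomorphism over `X` (the ideal sheaf and the image do not change). [cite: GortzWedhorn2023, Def. 19.19] -/
theorem isRegularImmersionOfCodim_of_iso (e : Z ≅ Z') (he : e.hom ≫ i' = i) {p : ℕ} (h : IsRegularImmersionOfCodim i p) :
    IsRegularImmersionOfCodim i' p := by
  have hi' : i' = e.inv ≫ i := by rw [← he, Iso.inv_hom_id_assoc]
  have hker : i'.ker = i.ker := by rw [hi', Scheme.Hom.ker_comp_of_isIso]
  haveI := h.1
  refine ⟨by rw [hi']; infer_instance, fun z' => ?_⟩
  obtain ⟨U, hzU, rs, hlen, hreg, hI⟩ := h.2 (e.inv.base z')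
  refine ⟨U, ?_, rs, hlen, hreg, by rw [hker]; exact hI⟩
  rw [hi', Scheme.Hom.comp_apply]
  exact hzU

variable {𝓕 : X.Modules} {s : unitModule X ⟶ 𝓕}

/-- **C5 does not depend on the chosen zero scheme.** -/
theorem _root_.Summit.HodgeConjecture.HodgeConjecture.Cruxes.BlochSeedDiscOne.SeedChecker.IsZeroSchemeOf.isRegularImmersionOfCodim_iff
    (hZ : IsZeroSchemeOf s i) (hZ' : IsZeroSchemeOf s i') {p : ℕ} :
    IsRegularImmersionOfCodim i p ↔ IsRegularImmersionOfCodim i' p := by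
  obtain ⟨e, he, he'⟩ := hZ.exists_iso hZ'
  exact ⟨isRegularImmersionOfCodim_of_iso e he, isRegularImmersionOfCodim_of_iso e.symm he'⟩

/-- **C6-integrality does not depend on the chosen zero scheme** (Mathlib `IsIntegral.of_isIso`). -/
theorem _root_.Summit.HodgeConjecture.HodgeConjecture.Cruxes.BlochSeedDiscOne.SeedChecker.IsZeroSchemeOf.isIntegral_iff
    (hZ : IsZeroSchemeOf s i) (hZ' : IsZeroSchemeOf s i') :
    AlgebraicGeometry.IsIntegral Z ↔ AlgebraicGeometry.IsIntegral Z' := by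
  obtain ⟨e, -, -⟩ := hZ.exists_iso hZ'
  exact ⟨fun _ => IsIntegral.of_isIso e.hom, fun _ => IsIntegral.of_isIso e.inv⟩

/-- **C6-codimension does not depend on the chosen zero scheme** (same image). -/
theorem _root_.Summit.HodgeConjecture.HodgeConjecture.Cruxes.BlochSeedDiscOne.SeedChecker.IsZeroSchemeOf.forall_coheight_iff
    (hZ : IsZeroSchemeOf s i) (hZ' : IsZeroSchemeOf s i') {n : ℕ∞} :
    (∀ z ∈ Set.range i.base, n ≤ Order.coheight z) ↔ ∀ z ∈ Set.range i'.base, n ≤ Order.coheight z := by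
  rw [hZ.range_eq hZ']

/-- **C5 for ANY zero scheme of `s` from regular coordinates of `s(1)` at its points** (§19.4 + transfer). [cite: Fulton1998, B.3.4 (PDF p. 411)] -/
theorem isRegularImmersionOfCodim_of_hasRegularCoordinatesAt {r : ℕ} (h𝓕 : IsFiniteLocallyFree 𝓕) (hZ : IsZeroSchemeOf s i)
    (h : ∀ x ∈ Set.range i.base, HasRegularCoordinatesAt 𝓕 (secOf s) r x) : IsRegularImmersionOfCodim i r := by
  rw [hZ.isRegularImmersionOfCodim_iff (isZeroSchemeOf_zeroSchemeι h𝓕 s)]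
  refine isRegularImmersionOfCodim_zeroSchemeι_of_hasRegularCoordinatesAt h𝓕 (secOf s) fun x hx => h x ?_
  rwa [hZ.range_eq_zeroSchemeι h𝓕]

end Transfer

/-! ## §19.6 The doors with no carrier input: (design json, rank-`4` presentation, global section) -/

section Doors

variable {E₀ : AbelianVariety ℂ} {ψ₀ : E₀ ⟶ E₀} {C : ChernCharacterBetti}

/-- **THE SEED CHECK DOES NOT DEPEND ON THE MODEL OF THE ZERO SCHEME** — except that C7 (`IsBlochSemiregular`, whose transport
along `Z ≅ Z'` over `S⁴` is not recorded in the tree) is re-read on the new model: `D.SeedCheck K i q`, `i` and `i'` zero schemes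
of the same section, C7 for `i'` ⟹ `D.SeedCheck K i' q`. -/
theorem _root_.Summit.HodgeConjecture.HodgeConjecture.Cruxes.BlochSeedDiscOne.SeedChecker.Design.SeedCheck.of_isZeroSchemeOf
    {D : Design} {K : AnchorKit E₀ ψ₀} {𝓕 : (pad4Anchor E₀).X.left.Modules}
    {s : unitModule (pad4Anchor E₀).X.left ⟶ 𝓕} {Z Z' : Scheme.{0}} {i : Z ⟶ (pad4Anchor E₀).X.left}
    {i' : Z' ⟶ (pad4Anchor E₀).X.left} {q : ℚ} (h : D.SeedCheck K i q) (hZ : IsZeroSchemeOf s i)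
    (hZ' : IsZeroSchemeOf s i') (hsr' : IsBlochSemiregular i' (2 * 4) 4) : D.SeedCheck K i' q := by
  obtain ⟨h0, -, hreg, hint, hcoh, -, hσ⟩ := h
  refine ⟨h0, hZ'.1, (hZ.isRegularImmersionOfCodim_iff hZ').mp hreg, (hZ.isIntegral_iff hZ').mp hint,
    (hZ.forall_coheight_iff hZ').mp hcoh, hsr', ?_⟩
  rw [← hZ.range_eq hZ']
  exact hσ

/-- **THE LCI DOOR FROM (design, presentation, SECTION) — no carrier, no `IsZeroSchemeOf` hypothesis**: `D` passes C0; `𝓕` of rank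
`4` on the anchor is (A1)-clean at the seed with the design's `μ` in a window `⊇ {1, 2, 3}`; `t ∈ Γ(S⁴, 𝓕)`; ITS ZERO SCHEME
`Z(t) ↪ S⁴` (the tree's `zeroSchemeι 𝓕 t`, which EXISTS — nothing to supply) passes C5, C6, C7 ⟹ `D.SeedCheck K (Z(t) ↪ S⁴) q` for
some `q`, GIVEN the named law `TopChernFourLocalisation C` exactly as in v4 (`Design.seedCheck_of_zeroScheme` with
`s := mulSection 𝓕 t`, `hZ := isZeroSchemeOf_mulSection`). Hypothesis-carrying; nothing is asserted. [cite: Fulton1998, §14.1 and B.3.4] -/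
theorem _root_.Summit.HodgeConjecture.HodgeConjecture.Cruxes.BlochSeedDiscOne.SeedChecker.Design.seedCheck_of_section
    (hE : E₀.dim = 1) (hψ : ψ₀ ≫ ψ₀ = -(1 • 𝟙 E₀)) {D : Design} (hC0 : D.ClassData) (K : AnchorKit E₀ ψ₀) {I : Finset ℕ}
    {𝓕 : (pad4Anchor E₀).X.left.Modules} (hloc : TopChernFourLocalisation C) (hrk : HasRank 𝓕 4)
    (hcl : CleanAtSeed C I K.F (hStd E₀ K.η) 𝓕 D.mu) (h1 : 1 ∈ I) (h2 : 2 ∈ I) (h3 : 3 ∈ I) (t : Γ(𝓕, ⊤))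
    (hreg : IsRegularImmersionOfCodim (zeroSchemeι 𝓕 t) 4) (hint : AlgebraicGeometry.IsIntegral (zeroScheme 𝓕 t))
    (hcoh : ∀ z ∈ Set.range (zeroSchemeι 𝓕 t).base, ((4 : ℕ) : ℕ∞) ≤ Order.coheight z)
    (hsr : IsBlochSemiregular (zeroSchemeι 𝓕 t) (2 * 4) 4) : ∃ q : ℚ, D.SeedCheck K (zeroSchemeι 𝓕 t) q :=
  D.seedCheck_of_zeroScheme hE hψ hC0 K hloc hrk hcl h1 h2 h3 (mulSection 𝓕 t)
    (isZeroSchemeOf_mulSection (HasRank.isFiniteLocallyFree' hrk) t) hreg hint hcoh hsr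

/-- **… WITH C5 READ AS «REGULAR SECTION»** (Fulton B.3.4): the regular-coordinates test at the points of `Z(t)` replaces the
regular-immersion hypothesis. [cite: Fulton1998, B.3.4 (PDF p. 411)] -/
theorem _root_.Summit.HodgeConjecture.HodgeConjecture.Cruxes.BlochSeedDiscOne.SeedChecker.Design.seedCheck_of_regularSection
    (hE : E₀.dim = 1) (hψ : ψ₀ ≫ ψ₀ = -(1 • 𝟙 E₀)) {D : Design} (hC0 : D.ClassData) (K : AnchorKit E₀ ψ₀) {I : Finset ℕ}
    {𝓕 : (pad4Anchor E₀).X.left.Modules} (hloc : TopChernFourLocalisation C) (hrk : HasRank 𝓕 4)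
    (hcl : CleanAtSeed C I K.F (hStd E₀ K.η) 𝓕 D.mu) (h1 : 1 ∈ I) (h2 : 2 ∈ I) (h3 : 3 ∈ I) (t : Γ(𝓕, ⊤))
    (hregc : ∀ x ∈ Set.range (zeroSchemeι 𝓕 t).base, HasRegularCoordinatesAt 𝓕 t 4 x)
    (hint : AlgebraicGeometry.IsIntegral (zeroScheme 𝓕 t))
    (hcoh : ∀ z ∈ Set.range (zeroSchemeι 𝓕 t).base, ((4 : ℕ) : ℕ∞) ≤ Order.coheight z)
    (hsr : IsBlochSemiregular (zeroSchemeι 𝓕 t) (2 * 4) 4) : ∃ q : ℚ, D.SeedCheck K (zeroSchemeι 𝓕 t) q :=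
  D.seedCheck_of_section hE hψ hC0 K hloc hrk hcl h1 h2 h3 t
    (isRegularImmersionOfCodim_zeroSchemeι_of_hasRegularCoordinatesAt (HasRank.isFiniteLocallyFree' hrk) t hregc) hint hcoh hsr

/-- **… FOR AN ARBITRARY MODEL OF THE ZERO SCHEME** (if a presenter prefers its own `i : Z ↪ S⁴` with `IsZeroSchemeOf s i`): the
closed-immersion and `4`-local-equations clauses are automatic (§19.2–§19.3), C5 may be certified by regular coordinates of `s(1)`. -/
theorem _root_.Summit.HodgeConjecture.HodgeConjecture.Cruxes.BlochSeedDiscOne.SeedChecker.Design.seedCheck_of_regularCoordinates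
    (hE : E₀.dim = 1) (hψ : ψ₀ ≫ ψ₀ = -(1 • 𝟙 E₀)) {D : Design} (hC0 : D.ClassData) (K : AnchorKit E₀ ψ₀) {I : Finset ℕ}
    {𝓕 : (pad4Anchor E₀).X.left.Modules} (hloc : TopChernFourLocalisation C) (hrk : HasRank 𝓕 4)
    (hcl : CleanAtSeed C I K.F (hStd E₀ K.η) 𝓕 D.mu) (h1 : 1 ∈ I) (h2 : 2 ∈ I) (h3 : 3 ∈ I)
    (s : unitModule (pad4Anchor E₀).X.left ⟶ 𝓕) {Z : Scheme.{0}} {i : Z ⟶ (pad4Anchor E₀).X.left} (hZ : IsZeroSchemeOf s i)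
    (hregc : ∀ x ∈ Set.range i.base, HasRegularCoordinatesAt 𝓕 (secOf s) 4 x) (hint : AlgebraicGeometry.IsIntegral Z)
    (hcoh : ∀ z ∈ Set.range i.base, ((4 : ℕ) : ℕ∞) ≤ Order.coheight z) (hsr : IsBlochSemiregular i (2 * 4) 4) :
    ∃ q : ℚ, D.SeedCheck K i q :=
  D.seedCheck_of_zeroScheme hE hψ hC0 K hloc hrk hcl h1 h2 h3 s hZ
    (isRegularImmersionOfCodim_of_hasRegularCoordinatesAt (HasRank.isFiniteLocallyFree' hrk) hZ hregc) hint hcoh hsr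

/-- **THE CRUX BY NAME FROM (design, presentation, section) ON EVERY CM ANCHOR** — v4's `blochSeedDiscOne_of_zeroSchemes` with the
carrier quantifiers `∃ Z i, IsZeroSchemeOf s i ∧ …` REMOVED (instantiated by `Z(t)`): per anchor `(E₀, ψ₀)` a design passing C0, a kit,
a window `⊇ {1,2,3}`, a rank-`4` presentation (A1)-clean at the seed, a global section `t` whose zero scheme passes C5, C6, C7; GIVEN
the law. HYPOTHESIS-CARRYING: no instance of `h` is constructed anywhere; `BlochSeedDiscOne` (18881) remains open. -/
theorem blochSeedDiscOne_of_sections (hloc : TopChernFourLocalisation C)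
    (h : ∀ (E₀ : AbelianVariety ℂ) (ψ₀ : E₀ ⟶ E₀), E₀.dim = 1 → ψ₀ ≫ ψ₀ = -(1 • 𝟙 E₀) →
      ∃ (D : Design) (_ : D.ClassData) (K : AnchorKit E₀ ψ₀) (I : Finset ℕ) (_ : 1 ∈ I) (_ : 2 ∈ I) (_ : 3 ∈ I)
        (𝓕 : (pad4Anchor E₀).X.left.Modules) (_ : HasRank 𝓕 4) (_ : CleanAtSeed C I K.F (hStd E₀ K.η) 𝓕 D.mu)
        (t : Γ(𝓕, ⊤)),
        IsRegularImmersionOfCodim (zeroSchemeι 𝓕 t) 4 ∧ AlgebraicGeometry.IsIntegral (zeroScheme 𝓕 t) ∧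
          (∀ z ∈ Set.range (zeroSchemeι 𝓕 t).base, ((4 : ℕ) : ℕ∞) ≤ Order.coheight z) ∧
            IsBlochSemiregular (zeroSchemeι 𝓕 t) (2 * 4) 4) :
    Summit.HodgeConjecture.HodgeConjecture.Theses.EightfoldBlochSeeds.BlochSeedDiscOne :=
  blochSeedDiscOne_of_zeroSchemes hloc fun E₀ ψ₀ hE hψ => by
    obtain ⟨D, hC0, K, I, h1, h2, h3, 𝓕, hrk, hcl, t, hreg, hint, hcoh, hsr⟩ := h E₀ ψ₀ hE hψ
    exact ⟨D, hC0, K, I, h1, h2, h3, 𝓕, hrk, hcl, mulSection 𝓕 t, zeroScheme 𝓕 t, zeroSchemeι 𝓕 t,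
      isZeroSchemeOf_mulSection (HasRank.isFiniteLocallyFree' hrk) t, hreg, hint, hcoh, hsr⟩

/-- **… with C5 read as «regular section» on every anchor.** [cite: Fulton1998, B.3.4 (PDF p. 411)] -/
theorem blochSeedDiscOne_of_regularSections (hloc : TopChernFourLocalisation C)
    (h : ∀ (E₀ : AbelianVariety ℂ) (ψ₀ : E₀ ⟶ E₀), E₀.dim = 1 → ψ₀ ≫ ψ₀ = -(1 • 𝟙 E₀) →
      ∃ (D : Design) (_ : D.ClassData) (K : AnchorKit E₀ ψ₀) (I : Finset ℕ) (_ : 1 ∈ I) (_ : 2 ∈ I) (_ : 3 ∈ I)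
        (𝓕 : (pad4Anchor E₀).X.left.Modules) (_ : HasRank 𝓕 4) (_ : CleanAtSeed C I K.F (hStd E₀ K.η) 𝓕 D.mu)
        (t : Γ(𝓕, ⊤)),
        (∀ x ∈ Set.range (zeroSchemeι 𝓕 t).base, HasRegularCoordinatesAt 𝓕 t 4 x) ∧
          AlgebraicGeometry.IsIntegral (zeroScheme 𝓕 t) ∧
          (∀ z ∈ Set.range (zeroSchemeι 𝓕 t).base, ((4 : ℕ) : ℕ∞) ≤ Order.coheight z) ∧
            IsBlochSemiregular (zeroSchemeι 𝓕 t) (2 * 4) 4) :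
    Summit.HodgeConjecture.HodgeConjecture.Theses.EightfoldBlochSeeds.BlochSeedDiscOne :=
  blochSeedDiscOne_of_sections hloc fun E₀ ψ₀ hE hψ => by
    obtain ⟨D, hC0, K, I, h1, h2, h3, 𝓕, hrk, hcl, t, hregc, hint, hcoh, hsr⟩ := h E₀ ψ₀ hE hψ
    exact ⟨D, hC0, K, I, h1, h2, h3, 𝓕, hrk, hcl, t,
      isRegularImmersionOfCodim_zeroSchemeι_of_hasRegularCoordinatesAt (HasRank.isFiniteLocallyFree' hrk) t hregc, hint, hcoh, hsr⟩

end Doors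

/-! ## §19.7 Flags and audit

FLAGS (for the cell's C5–C8 table; «vacuous ∕ implied» column):
* the `IsClosedImmersion i` conjunct of `Design.SeedCheck` and v15's hypothesis `[IsClosedImmersion i]`: IMPLIED for zero schemes
  (`IsZeroSchemeOf s i` carries it; the canonical `Z(t) ↪ S⁴` is one, `isClosedImmersion_zeroSchemeι`);
* v15's `LocallyGeneratedBy i 4` (the «`4` local equations» half of C5): IMPLIED by `HasRank 𝓕 4` for every zero scheme of a
  section of the presentation (`locallyGeneratedBy_of_isZeroSchemeOf`) — hence, in the joint file (once v5–v15.1 build), v15's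
  `isRegularImmersionOfCodim_pad4` ∕ `seedCheck_iff_schemeDim` apply to `Z(t)` with no carrier hypothesis left: on `S⁴`
  **C5 ∧ C6-codim ⟺ `Z(t)` integral of dimension `4`** for zero schemes of sections of rank-`4` presentations;
* the carrier `(Z, i, IsZeroSchemeOf s i)` of v4's doors: NOT AN INPUT (exists, `exists_isZeroSchemeOf`; unique, `….exists_iso`);
  the verdict is model-independent for C0, C5, C6, (σ) (`Design.SeedCheck.of_isZeroSchemeOf`), C7 being re-read on the model;
* `HasRegularCoordinatesAt` is a SUFFICIENT test for C5 (Fulton's definition of a regular section), not claimed equivalent;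
* nothing here is vacuous: every predicate is inhabited-or-not depending on the presentation, and no hypothesis list of a door is
  contradictory by construction (each is a conjunction of independent clauses read on data that is not constructed here). -/

/-- **AUDIT (nothing toward HC is decided in this file).** PROVED outright: §19.1–§19.5. HYPOTHESIS-CARRYING (honest doors; no
instance of their hypotheses — design json passing C0, rank-`4` (A1)-clean presentation, section with C5–C7 zero scheme, the law
`TopChernFourLocalisation C` — is constructed): §19.6. NOT touched: `stub_rung_pad4_seedAt`, `BlochSeedDiscOne` (18881), `HC`,
`HC_CM`, `HC_AV`, № 4, 26512, H2 — all exactly as open as before. -/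
theorem audit_nothing_decided : True := trivial

end Summit.HodgeConjecture.HodgeConjecture.Cruxes.BlochSeedDiscOne.SeedChecker.ZeroLocus

end
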